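import Summits.BirchSwinnertonDyer.Rank1Residual.Partition.MainConjecturesIrreducibleClass
import Summits.BirchSwinnertonDyer.Rank1Residual.Partition.AnticyclotomicControlJSW
import Literature.NumberTheory.EllipticCurves.Jetchev2008.HeegnerIndexTamagawaBound
import Literature.NumberTheory.EllipticCurves.BSDQuadraticDescentTorsionOddPartProofs
import HarnessLib

/-!
# The Tamagawa proviso `p ∤ ∏ c_ℓ` of the irreducible rank-one rows, RELAXED: Kolyvagin's upper bound
# replaced by Jetchev's Tamagawa-sharpened bound (Compos. Math. 144 (2008) Cor. 1.5) in the kernel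
# derivation "anticyclotomic MC + control + BDP + cyclotomic MC of the twist ⇒ BSD_p" (cell `b2b-bsdres`,
# GLUE seat gen 8; companion of `MainConjecturesIrreducibleClass.lean` / `AnticyclotomicControlJSW.lean`)

HONEST FRAMING (cell `b2b-bsdres`, run/shared/lean/b2b/bsd-rank1-residual/, verbatim in every
file): the goal of the cell is to DELETE the COMBINATION-SHAPED residual classes of the
Birch–Swinnerton-Dyer formula for ALL analytic-rank `≤ 1` elliptic curves over `ℚ` — "full BSD
formula for every rank `≤ 1` curve in class `C`" assembled STRICTLY from published theorems — so
that the rank-`≤ 1` remainder becomes exactly the CONSTRUCTION-SHAPED classes, which are TYPED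
(missing-input `Prop`s), NOT attempted. This is not "finishing BSD". Research routes; no claim
beyond the stated classes; nothing booked; no label changes. THEOREMS ONLY (no definition, no named
fact, no `sorry`); every published theorem enters as one of the tree's existing named Literature
facts BY NAME; every unproved / untyped-in-Literature statement enters as an EXPLICIT binder.

## What this file records (and why the binder `htam` was there)

The MC-level kernel derivation of the covered rank-one rows C2 (Burungale–Castella–Skinner 2025
Cor. 1.3.1), C16 (Yan–Zhu 2026 Thm. 4.15) and C3-ordinary (Jetchev–Skinner–Wan 2017 Thm. 1.2.1) —
GLUE gens 2–7, statement of record `bsdp_of_covered_of_mainConjectures_allPrimes_published_numbered` —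
carries the binder `htam : r = 1 → Irr → Surj → p ∤ ∏_ℓ c_ℓ(E)`, which is NOT a hypothesis of the
printed theorems. Its origin is the UPPER bound: over the all-split Heegner field `K` of the tree's
STEP-L currency (`X11b.IndexLowerBoundAt`: `2·ord_p [E(K):ℤP] ≤ ord_p #Ш(E/K) + 2·ord_p ∏_ℓ c_ℓ(E)`,
the Tamagawa term of BSD over `K` being `ord_p ∏_w c_w(E/K) = 2·ord_p ∏_ℓ c_ℓ(E)`), Kolyvagin's bound
`ord_p #Ш(E/K) ≤ 2·ord_p [E(K):ℤP]` (`Kolyvagin1990_padicValNat_card_sha_le`) is blind to the Tamagawa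
term, so the identity `X11b.IndexIdentityAt` (what the descent `X11b.bsdp_of_indexIdentityAt` consumes)
follows only when that term vanishes (`X11b.indexIdentityAt_of_lowerBound_of_kolyvagin`). Jetchev–Skinner–
Wan remove the restriction in print (§7.4.2, arXiv:1512.06894 p. 31) by running Kolyvagin's argument over
a SECOND auxiliary field `K″` for a Shimura-curve parametrisation `X_{N⁺,N⁻}` chosen so that "there are
no `w ∣ N⁺` such that `p ∣ c_w(E/K″)`" — a currency the tree does not have (sized ask A14 of the seat's
GLUE.md, L). In the CLASSICAL currency the printed lever is D. Jetchev, *Global divisibility of Heegner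
points and Tamagawa numbers*, Compos. Math. 144 (2008) Cor. 1.5 — `#Ш(E/K)[p^∞] ≤ p^{2m₀ − 2m_max}`,
`m_max = max_{q∣N} ord_p c_q`, under Hypothesis (∗): `p ∤ N`, `ρ̄_{E,p}` surjective, for the Heegner
point of an OPTIMAL parametrisation — the tree's named fact
`Jetchev2008.cor15_padicValNat_card_primaryComponent_sha_le` (A27, PUB; monotone form "for every prime
`q ∣ N`: `ord_p #Ш(E/K)[p^∞] + 2·ord_p c_q(E) ≤ 2·ord_p [E(K):ℤP]`"; JSW p. 4: "this … will only give
the precise upper bounds … if at most one Tamagawa number of `E` is divisible by `p`"). So when the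
`p`-divisibility of the Tamagawa numbers of `E` is CONCENTRATED AT ONE bad prime `q`
(`ord_p ∏_ℓ c_ℓ(E) ≤ ord_p c_q(E)`, i.e. at most one Tamagawa number divisible by `p`), Jetchev's bound
and STEP L give the identity (`X11b.indexIdentityAt_of_lowerBound_of_jetchev`), and the whole chain
below the identity (multr1's descent, the twist's cyclotomic main conjecture, Greenberg 4.1, …) runs
unchanged. This file re-derives, with `hB`/`htam0` ↦ `hJ` + optimality + concentration:

* `X11b.indexIdentityAt_of_lowerBound_of_jetchev` — the identity over `K` (bookkeeping: `omega`);
* `X11b.bsdp_rankOne_of_indexLowerBoundAt_of_twist_mazurMainConjecture_of_jetchev` — gen 2's datum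
  theorem (STEP L + the twist's typed cyclotomic MC + Greenberg 4.1 + GZ + Kolyvagin ⇒ `BSD(E,p)`);
* `bsdp_rankOne_of_indexLowerBoundAt_of_columnMainConjecture_of_jetchev` — gen 2's CLASS-level generic
  theorem (field by Hoffstein–Luo, Manin-unit datum by Mazur, twist transports), binders `hopt`
  (`E` carries an optimal parametrisation datum at level `N_E`, Jetchev's setting) and `htam1`
  (concentration at one `q ∣ N_E`) in place of `htam0`;
* `bsdp_rankOne_of_thm331_of_columnMainConjecture_odd_of_jetchev` — gen 6's generic theorem with the
  control link PUBLISHED (JSW 2017 Thm. 3.3.1), same replacement.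

The row theorems and the all-primes statement of record with the relaxed proviso are in the companion
files `MainConjecturesTamagawaJetchevRows.lean` / `MainConjecturesCoveredAllPrimesJetchev.lean`.
What is NOT reached (said plainly): pairs with `p ∣ c_ℓ(E)` at TWO OR MORE bad primes `ℓ` (JSW's `K″`
argument; A14), and non-optimal `E` with `p ∣ ∏c_ℓ` except through an optimal isogenous curve and
Cassels' isogeny invariance of `BSD(E,p)` (companion file).

References: D. Jetchev, Compos. Math. 144 (2008) 811–826, Hypothesis (∗), Thm. 1.4, Cor. 1.5 (p. 3)
[Jetchev2008]; Jetchev–Skinner–Wan, Camb. J. Math. 5 (2017), §1 (p. 4), §7.4.1–7.4.2 (pp. 30–31),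
Thm. 3.3.1 [JetchevSkinnerWan2017]; Burungale–Castella–Skinner, IMRN 2025, Cor. 1.3.1 and its proof
(p. 4) [BurungaleCastellaSkinner2025]; W. McCallum, LMS LN 153 (1991) §1 [McCallumLMS1991];
R. L. Miller, LMS J. Comput. Math. 14 (2011) Def. 1.1 [Miller2011LMS]; HOME/b2b-bsdres-lit-glue/GLUE.md
§G7.4 (A14), GEN 8 ADDENDUM.
-/

set_option autoImplicit false

noncomputable section

open scoped Classical

open WeierstrassCurve NumberField IsDedekindDomain Literature.NumberTheory.EllipticCurves
  Literature.NumberTheory.EllipticCurves.ModularForms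
  Literature.NumberTheory.EllipticCurves.Rank1Residual
  Literature.NumberTheory.EllipticCurves.JetchevSkinnerWan2017
  Summit.BirchSwinnertonDyer.BirchSwinnertonDyer.Theorems.Rank1ResidualX1Defs

namespace Summit.BirchSwinnertonDyer.Rank1Residual

namespace X11b

/-! ### §1 The identity over `K` from STEP L and Jetchev's bound -/

/-- **The Heegner-index identity over `K` from STEP L and JETCHEV's Tamagawa-sharpened bound** (the
twin of `indexIdentityAt_of_lowerBound_of_kolyvagin` off `p ∤ ∏c_ℓ`). Data: `E/ℚ` with an OPTIMAL
parametrisation datum at level `N` (`hopt`, Jetchev's setting: `c·Λ_f = Λ_E`), `K` imaginary quadratic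
with `d_K ≠ −3` and the Heegner hypothesis for `N`, `P ∈ E(K)` a Heegner point of infinite order, `p`
odd with `p ∤ N` and `ρ̄_{E,p}` surjective (Hypothesis (∗)), `Ш(E/K)` finite, and ONE prime `q ∣ N` at
which the `p`-divisibility of the Tamagawa numbers of `E` is concentrated:
`ord_p ∏_ℓ c_ℓ(E) ≤ ord_p c_q(E)` (`htq`; automatic when `p ∤ ∏c_ℓ`, and otherwise saying that `q` is
the ONLY bad prime with `p ∣ c_q`). Then Jetchev 2008 Cor. 1.5 (`hJ`, monotone form at `q`:
`ord_p #Ш(E/K)[p^∞] + 2·ord_p c_q ≤ 2·ord_p [E(K):ℤP]`) and STEP L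
(`2·ord_p [E(K):ℤP] ≤ ord_p #Ш(E/K) + 2·ord_p ∏c_ℓ`) squeeze to the identity
`2·ord_p ∏c_ℓ + ord_p #Ш(E/K) = 2·ord_p [E(K):ℤP]`; `ord_p #Ш(E/K)[p^∞] = ord_p #Ш(E/K)` for the
finite group `Ш(E/K)` (`natCard_primaryComponent_eq_pow_padicValNat`).
[cite: Jetchev2008, Cor. 1.5 (p. 3)] [cite: JetchevSkinnerWan2017, §1 (p. 4), §7.4.1 (eq:shalowerK-1), §7.4.2 (p. 31)]
[cite: Castella2018, (5.3) (p. 12)] -/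
theorem indexIdentityAt_of_lowerBound_of_jetchev
    (W : WeierstrassCurve ℚ) [W.IsElliptic] (p : ℕ) [Fact p.Prime] {N : ℕ} [NeZero N]
    {K : Type} [Field K] [NumberField K]
    (hJ : Jetchev2008.cor15_padicValNat_card_primaryComponent_sha_le)
    (hK : IsImaginaryQuadratic K) (hD3 : NumberField.discr K ≠ -3)
    (hH : SatisfiesHeegnerHypothesis N K)
    (hopt : ∃ Dt : ModularParametrizationData W N,
      ∀ z ∈ Dt.L.lattice, ∃ w ∈ periodLattice Dt.f, z = (Dt.c : ℂ) * w)
    {P : (W.baseChange K).toAffine.Point} (hP : IsHeegnerPoint N W K P) (hnt : ¬ IsOfFinAddOrder P)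
    (hp2 : p ≠ 2) (hpN : ¬ p ∣ N) (hρ : W.HasSurjectiveModNGaloisRep p)
    {q : ℕ} [Fact q.Prime] (hqN : q ∣ N)
    (htq : padicValNat p W.tamagawaProduct ≤
      padicValNat p ((W.baseChange ℚ_[q]).localTamagawaNumber ℤ_[q]))
    [Finite (W.baseChange K).sha]
    (hL : IndexLowerBoundAt W p K P) : IndexIdentityAt W p K P := by
  have hb := hJ N W K hK hD3 hH hopt hP hnt p hp2 hpN hρ q hqN
  have hprim : padicValNat p (Nat.card (AddCommGroup.primaryComponent (W.baseChange K).sha p)) =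
      padicValNat p (W.baseChange K).shaOrder := by
    rw [natCard_primaryComponent_eq_pow_padicValNat (A := (W.baseChange K).sha) p,
      padicValNat.prime_pow, WeierstrassCurve.shaOrder]
  unfold IndexLowerBoundAt at hL
  unfold IndexIdentityAt
  omega

/-! ### §2 The datum theorem (gen 2's, Jetchev form) -/

/-- **Rank one at a classical Heegner datum, JETCHEV form** — gen 2's
`bsdp_rankOne_of_indexLowerBoundAt_of_twist_mazurMainConjecture` with Kolyvagin's bound `hB` and the
proviso `p ∤ ∏c_ℓ` REPLACED by Jetchev 2008 Cor. 1.5 (`hJ`), an optimal parametrisation datum of `E`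
at level `N` (`hopt`), `p ∤ N` (`hpN`), `d_K ≠ −3` (`hD3`) and ONE prime `q ∣ N` carrying all the
`p`-divisibility of the Tamagawa numbers (`htq`). Everything else verbatim: Gross–Zagier (`hGZ`),
Kolyvagin (`hKo`: rank one and finite `Ш` over `K`), Greenberg 4.1 (`hGr`), GZK, modularity; the pair
(`r_an = 1`, `p ≥ 3`, `ρ̄_{E,p}` onto); the datum (`K`, Manin-unit `Dt`, `P`, `p ∤ #𝓞_K^×`,
`L(E^{d_K},1) ≠ 0`); a globally minimal good-ordinary model `Wd` of the twist with the transports; the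
TYPED inputs `hMCd` (the twist's cyclotomic main conjecture) and `hL` (STEP L at the datum). Proof:
`P` is non-torsion (GZ), §1 gives the identity over `K` granted finiteness, the twist's rank-`0`
`p`-part from its main conjecture (`padicValRat_bsd_rank_zero_of_mazurMainConjecture`), then multr1's
descent `bsdp_of_indexIdentityAt`. [cite: Jetchev2008, Cor. 1.5 (p. 3)]
[cite: JetchevSkinnerWan2017, §7.4.1–7.4.2 (pp. 30–31)] [cite: GreenbergLNM1716, Thm. 4.1 (p. 102)]
[cite: Miller2011LMS, Def. 1.1] -/
theorem bsdp_rankOne_of_indexLowerBoundAt_of_twist_mazurMainConjecture_of_jetchev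
    (W : WeierstrassCurve ℚ) [W.IsElliptic] [W.IsGloballyMinimal] (p : ℕ) [Fact p.Prime]
    (N : ℕ) [NeZero N] (K : Type) [Field K] [NumberField K]
    (Dt : ModularParametrizationData W N) (H : HeegnerDatum N (NumberField.discr K)) (ι : K →+* ℂ)
    (P : (W.baseChange K).toAffine.Point)
    -- the published inputs (named facts of the tree)
    (hGZ : gross_zagier N W K) (hKo : kolyvagin N W K)
    (hJ : Jetchev2008.cor15_padicValNat_card_primaryComponent_sha_le)
    (hGr : greenberg_charValue_rankZero)
    (hGZK : rank_eq_analyticRank_of_analyticRank_le_one) (hmod : hasEntireLFunction_rat)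
    (hpar : nonempty_modularParametrizationData)
    -- the pair, Jetchev's Hypothesis (∗), optimality, concentration of the Tamagawa `p`-divisibility
    (hr : W.analyticRank = 1) (hp3 : 3 ≤ p) (hsurj : Surj W p) (hpN : ¬ p ∣ N)
    (hopt : ∃ Dt : ModularParametrizationData W N,
      ∀ z ∈ Dt.L.lattice, ∃ w ∈ periodLattice Dt.f, z = (Dt.c : ℂ) * w)
    {q : ℕ} [Fact q.Prime] (hqN : q ∣ N)
    (htq : padicValNat p W.tamagawaProduct ≤
      padicValNat p ((W.baseChange ℚ_[q]).localTamagawaNumber ℤ_[q]))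
    -- the Heegner data
    (hK : IsImaginaryQuadratic K) (hD3 : NumberField.discr K ≠ -3)
    (hHN : SatisfiesHeegnerHypothesis N K)
    (hP : WeierstrassCurve.Affine.Point.map ι.toRatAlgHom P = heegnerPointComplex Dt H)
    (hc : ¬ (p : ℤ) ∣ Dt.c) (hμ : ¬ p ∣ Units.torsionOrder K)
    (hLt : (W.quadraticTwist (NumberField.discr K : ℚ)).entireLFunction 1 ≠ 0)
    -- a globally minimal model of the twist, good ordinary at `p`, the side conditions
    (Wd : WeierstrassCurve ℚ) [Wd.IsElliptic] [Wd.IsGloballyMinimal] (Cd : VariableChange ℚ)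
    (hWd : Cd • W.quadraticTwist (NumberField.discr K : ℚ) = Wd) (hordd : GoodOrd Wd p)
    (htam : padicValNat p Wd.tamagawaProduct = padicValNat p W.tamagawaProduct)
    (hu : padicValRat p (Cd.u : ℚ) = 0)
    -- the typed inputs: the twist's cyclotomic main conjecture and STEP L at the datum
    (hMCd : MazurMainConjecture Wd p) (hL : IndexLowerBoundAt W p K P) : BSDp W p := by
  have hp2 : p ≠ 2 := by omega
  have hD0 : (NumberField.discr K : ℚ) ≠ 0 := by exact_mod_cast NumberField.discr_ne_zero K
  haveI hEt : (W.quadraticTwist (NumberField.discr K : ℚ)).IsElliptic :=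
    W.isElliptic_quadraticTwist hD0
  -- the Heegner point has infinite order (Gross–Zagier, `L'(E,1) ≠ 0`, `L(E^D,1) ≠ 0`)
  have hPinf : ¬ IsOfFinAddOrder P :=
    not_isOfFinAddOrder_of_heegner_of_analyticRank_eq_one W N K Dt H ι P hGZ hmod hr hK hHN hLt hP
  -- STEP L + Jetchev's STEP U ⇒ the identity over `K`
  have hid : Finite (W.baseChange K).sha → IndexIdentityAt W p K P := fun hfin ↦
    haveI := hfin
    indexIdentityAt_of_lowerBound_of_jetchev W p hJ hK hD3 hHN hopt ⟨Dt, H, ι, hP⟩ hPinf hp2 hpN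
      hsurj hqN htq hL
  -- the twist: analytic rank `0`, finiteness, and its rank-`0` `p`-part FROM ITS MAIN CONJECTURE
  have hLt' : (W.quadraticTwist (NumberField.discr K : ℚ)).entireLFunction = Wd.entireLFunction := by
    rw [← hWd, entireLFunction_smul]
  have hLd1 : Wd.entireLFunction 1 ≠ 0 := by rw [← hLt']; exact hLt
  have hfinSd : Finite Wd.sha := (hGZK Wd (by
    rw [(Wd.analyticRank_eq_zero_iff_holds (hmod Wd)).2 hLd1]; exact zero_le_one)).2
  have htw := padicValRat_bsd_rank_zero_of_mazurMainConjecture Wd p hordd.1 hordd.2 hLd1 hfinSd hpar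
    (fun κ γ hκ hγ hγ' D _ hX fE hfE hSel ↦
      hGr Wd p hp2 hordd.1 hordd.2 κ γ hκ hγ hγ' D hX fE hfE hSel) hMCd
  exact bsdp_of_indexIdentityAt W p N K Dt H ι P hGZ hKo hGZK hmod hK hHN hP hp2 hc hμ hr hLt Wd Cd
    hWd htw htam hu hid

end X11b

/-! ### §3 Rank one at the CLASS level, Jetchev form (gen 2's generic theorem) -/

/-- **Rank one at the class level from the column's typed main conjecture, JETCHEV form** — gen 2's
`bsdp_rankOne_of_indexLowerBoundAt_of_columnMainConjecture` with `hB` (Kolyvagin's bound) and `htam0`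
(`p ∤ ∏c_ℓ`) REPLACED by Jetchev 2008 Cor. 1.5 (`hJ`, PUBLISHED named fact) and its two side
conditions on the pair: `hopt` — `E` (the globally minimal `W`) carries an OPTIMAL parametrisation
datum at its conductor (`c·Λ_f = Λ_E`: `E` is the `X₀(N)`-optimal curve of its class, Jetchev's
setting) — and `htam1` — ONE bad prime `q ∣ N_E` carries all the `p`-divisibility of the Tamagawa
numbers (`ord_p ∏_ℓ c_ℓ(E) ≤ ord_p c_q(E)`: at most one Tamagawa number divisible by `p`). All other
binders verbatim (published facts `hGZ`, `hKo`, `hGr`, `hGZK`, `hmod`, `hpar`, `hnf`, `hHL`, `hMaz`,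
`hNS`; the pair `p ≥ 3` good ordinary, `ρ̄` onto, `r_an = 1`; the column's typed MC `hMC` and
(im)-witness `hIm` at `p`; STEP L `hL` at every Manin-unit classical Heegner datum over a field with
`d_K` odd `< −4`, every `ℓ ∣ N` and `p` split, `L(E^{d_K},1) ≠ 0`). Proof = gen 2's (sign `−1`;
Hoffstein–Luo field; `w_K = 2`; `p ∤ d_K`; Manin-unit datum at `p ∤ N`; Néron model of the twist and
the transports), ending in §2; `p ∤ N_E` from good reduction, `d_K ≠ −3` from `d_K < −4`.
[cite: Jetchev2008, Hypothesis (∗), Cor. 1.5 (p. 3)] [cite: BurungaleCastellaSkinner2025, Cor. 1.3.1 (r = 1), proof (p. 4)]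
[cite: JetchevSkinnerWan2017, §7.4.1–7.4.2 (pp. 30–31)] [cite: HoffsteinLuo1997, Theorem (§1)]
[cite: Mazur1978, Cor. 4.1] [cite: Miller2011LMS, Def. 1.1] -/
theorem bsdp_rankOne_of_indexLowerBoundAt_of_columnMainConjecture_of_jetchev
    -- published inputs (named facts of the tree)
    (hGZ : ∀ (N : ℕ) [NeZero N] (W : WeierstrassCurve ℚ) (K : Type) [Field K] [NumberField K],
      gross_zagier N W K)
    (hKo : ∀ (N : ℕ) [NeZero N] (W : WeierstrassCurve ℚ) (K : Type) [Field K] [NumberField K],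
      kolyvagin N W K)
    (hJ : Jetchev2008.cor15_padicValNat_card_primaryComponent_sha_le)
    (hGr : greenberg_charValue_rankZero) (hGZK : rank_eq_analyticRank_of_analyticRank_le_one)
    (hmod : hasEntireLFunction_rat) (hpar : nonempty_modularParametrizationData)
    (hnf : exists_isNewformOf) (hHL : HoffsteinLuo1997_exists_twist_L_one_ne_zero)
    (hMaz : mazur_not_dvd_maninConstant_of_odd) (hNS : integral_neronScaling_of_isGloballyMinimal)
    -- the pair
    (W : WeierstrassCurve ℚ) [W.IsElliptic] [W.IsGloballyMinimal] (p : ℕ) [Fact p.Prime]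
    (hp3 : 3 ≤ p) (hord : GoodOrd W p) (hsurj : Surj W p) (hr : W.analyticRank = 1)
    -- Jetchev's setting: `E` optimal; the Tamagawa `p`-divisibility concentrated at one bad prime
    (hopt : ∀ (N : ℕ) [NeZero N], W.conductorNorm ℤ = N →
      ∃ Dt : ModularParametrizationData W N,
        ∀ z ∈ Dt.L.lattice, ∃ w ∈ periodLattice Dt.f, z = (Dt.c : ℂ) * w)
    (htam1 : ∃ (q : ℕ) (_ : Fact q.Prime), q ∣ W.conductorNorm ℤ ∧
      padicValNat p W.tamagawaProduct ≤ padicValNat p ((W.baseChange ℚ_[q]).localTamagawaNumber ℤ_[q]))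
    -- the column's typed main conjecture at `p`, and the (im)-from-surj witness at `p`
    (hMC : ∀ (V : WeierstrassCurve ℚ) [V.IsElliptic] [V.IsGloballyMinimal],
      GoodOrd V p → Irr V p → BigIm V p → MazurMainConjecture V p)
    (hIm : ∀ (V : WeierstrassCurve ℚ) [V.IsElliptic] [V.IsGloballyMinimal],
      GoodOrd V p → Surj V p → BigIm V p)
    -- the typed input (STEP L) for this pair at every Manin-unit Heegner datum over a BCS/YZ field
    (hL : ∀ (N : ℕ) [NeZero N] (K : Type) [Field K] [NumberField K]
      (Dt : ModularParametrizationData W N) (H : HeegnerDatum N (NumberField.discr K)) (ι : K →+* ℂ)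
      (P : (W.baseChange K).toAffine.Point),
      W.conductorNorm ℤ = N → IsImaginaryQuadratic K → Odd (NumberField.discr K) →
      NumberField.discr K < -4 → SatisfiesHeegnerHypothesis N K → SatisfiesHeegnerHypothesis p K →
      (W.quadraticTwist (NumberField.discr K : ℚ)).entireLFunction 1 ≠ 0 →
      WeierstrassCurve.Affine.Point.map ι.toRatAlgHom P = heegnerPointComplex Dt H →
      ¬ (p : ℤ) ∣ Dt.c → X11b.IndexLowerBoundAt W p K P) :
    BSDp W p := by
  have hpP : p.Prime := Fact.out
  have hp2 : p ≠ 2 := by omega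
  have hgood : Good W p := hord.1
  have hirr : Irr W p := irr_of_surj W p hsurj
  haveI : NeZero (W.conductorNorm ℤ) := ⟨(W.conductorNorm_pos_holds).ne'⟩
  -- Jetchev's Hypothesis (∗): `p ∤ N_E` at a good prime
  have hpN : ¬ p ∣ W.conductorNorm ℤ := fun h ↦
    (W.dvd_conductorNorm_iff_not_hasGoodReductionAtPrime p).mp h hgood
  -- the bad prime carrying the Tamagawa `p`-divisibility
  obtain ⟨q, hq, hqN, htq⟩ := htam1
  haveI : Fact q.Prime := hq
  -- the sign of the functional equation is `−1` (modularity, `r_an = 1`)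
  have hw : W.rootNumber = -1 := by
    rw [WeierstrassCurve.rootNumber_eq_neg_one_pow_analyticRank_of_exists_isNewformOf hnf W, hr]
    norm_num
  -- the field (Hoffstein–Luo): `d_K ≡ 1 (mod 8)`, `d_K < −4`, every `ℓ ∣ N` and `p` split,
  -- `L(E^{d_K},1) ≠ 0`
  obtain ⟨K, _, _, hK, hodd, hlt, hHN, hHp, hLt⟩ :=
    exists_admissibleField_of_rootNumber_eq_neg_one hnf hHL W hw p
  have hD3 : NumberField.discr K ≠ -3 := by omega
  -- `p ∤ d_K` (`p` splits) and `w_K = 2`, prime to `p`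
  have hpd : ¬ (p : ℤ) ∣ NumberField.discr K := not_dvd_discr_of_split hK hpP hp2 hHp
  have hμ : ¬ p ∣ Units.torsionOrder K := by
    haveI : IsTotallyComplex K := hK.2
    rw [Literature.NumberTheory.DiophantineGeometry.torsionOrder_eq_two_of_discr_lt hK.1 hlt]
    intro h2
    have := Nat.le_of_dvd two_pos h2
    omega
  -- the Manin-unit Heegner datum at the good prime `p`
  obtain ⟨Dt, H, ι, P, hP, hc⟩ :=
    X11b.exists_maninDatum_of_good hnf hMaz hNS W p (W.conductorNorm ℤ) K rfl hp2 hgood hirr hK hHN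
  -- a globally minimal model of the twist (Néron) and the transports
  have hD0 : (NumberField.discr K : ℚ) ≠ 0 := by exact_mod_cast NumberField.discr_ne_zero K
  haveI hEt : (W.quadraticTwist (NumberField.discr K : ℚ)).IsElliptic :=
    W.isElliptic_quadraticTwist hD0
  obtain ⟨Cd, hCd⟩ := hasGlobalMinimalModel_rat_holds (W.quadraticTwist (NumberField.discr K : ℚ))
  haveI : (Cd • W.quadraticTwist (NumberField.discr K : ℚ)).IsGloballyMinimal := hCd
  have hWd : Cd • W.quadraticTwist (NumberField.discr K : ℚ) =
      Cd • W.quadraticTwist (NumberField.discr K : ℚ) := rfl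
  have hordd : GoodOrd (Cd • W.quadraticTwist (NumberField.discr K : ℚ)) p :=
    X11b.goodOrd_twist_model W p K hK.1 hp2 hpd hord Cd hWd
  have hsurjd : Surj (Cd • W.quadraticTwist (NumberField.discr K : ℚ)) p :=
    X11b.surj_twist_model W p K hsurj Cd hWd
  have hirrd : Irr (Cd • W.quadraticTwist (NumberField.discr K : ℚ)) p := irr_of_surj _ p hsurjd
  have himd : BigIm (Cd • W.quadraticTwist (NumberField.discr K : ℚ)) p := hIm _ hordd hsurjd
  have htam : padicValNat p (Cd • W.quadraticTwist (NumberField.discr K : ℚ)).tamagawaProduct =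
      padicValNat p W.tamagawaProduct :=
    X2.padicValNat_tamagawaProduct_twist_of_heegner_of_odd W p hp2 K hK hodd hpd hHN Cd hWd
  have hu : padicValRat p (Cd.u : ℚ) = 0 :=
    X11b.padicValRat_u_eq_zero_of_twist_good W p hpd hgood Cd hWd hordd.1
  exact X11b.bsdp_rankOne_of_indexLowerBoundAt_of_twist_mazurMainConjecture_of_jetchev W p
    (W.conductorNorm ℤ) K Dt H ι P (hGZ _ W K) (hKo _ W K) hJ hGr hGZK hmod hpar hr hp3 hsurj hpN
    (hopt _ rfl) hqN htq hK hD3 hHN hP hc hμ hLt (Cd • W.quadraticTwist (NumberField.discr K : ℚ)) Cd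
    hWd hordd htam hu (hMC _ hordd hirrd himd) (hL _ K Dt H ι P rfl hK hodd hlt hHN hHp hLt hP hc)

/-! ### §4 The same with the anticyclotomic control link PUBLISHED (gen 6's generic theorem) -/

/-- **Rank one, generic odd prime `p ≥ 3`, anomalous or not, JETCHEV form** — gen 6's
`bsdp_rankOne_of_thm331_of_columnMainConjecture_odd` (the column's typed cyclotomic MC + JSW 2017
Thm. 3.3.1 = PUBLISHED anticyclotomic control + the typed anticyclotomic IMC ∘ BDP `hLA` in JSW's
letter + (irred_𝒦) at the Heegner fields ⇒ `BSD(E,p)`) with `hB`/`htam0` REPLACED by Jetchev 2008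
Cor. 1.5 (`hJ`) + `hopt` (optimal datum at `N_E`) + `htam1` (Tamagawa `p`-divisibility concentrated at
one bad prime). Proof verbatim: STEP L at each admissible datum from `h331` + `hLA`
(`X11b.indexLowerBoundAt_of_heegner_of_thm331_of_embedding`) at one anticyclotomic `(κ, γ)`, a prime
`𝔭 ∣ p` and THE embedding `embAt 𝔭`; then §3.
[cite: Jetchev2008, Cor. 1.5 (p. 3)] [cite: JetchevSkinnerWan2017, Thm. 3.3.1 with §3.5 (3.5.d), §7.4.1–7.4.2]
[cite: BurungaleCastellaSkinner2025, Thm. 1.2.4, Cor. 1.3.1 (r = 1)] [cite: YanZhu2024MainConjNonCM, Thm. 4.12]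
[cite: Miller2011LMS, Def. 1.1] -/
theorem bsdp_rankOne_of_thm331_of_columnMainConjecture_odd_of_jetchev
    -- published inputs (named facts of the tree)
    (hGZ : ∀ (N : ℕ) [NeZero N] (W : WeierstrassCurve ℚ) (K : Type) [Field K] [NumberField K],
      gross_zagier N W K)
    (hKo : ∀ (N : ℕ) [NeZero N] (W : WeierstrassCurve ℚ) (K : Type) [Field K] [NumberField K],
      kolyvagin N W K)
    (hJ : Jetchev2008.cor15_padicValNat_card_primaryComponent_sha_le)
    (h331 : thm331_anticyclotomicControl)
    (hGr : greenberg_charValue_rankZero) (hGZK : rank_eq_analyticRank_of_analyticRank_le_one)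
    (hmod : hasEntireLFunction_rat) (hpar : nonempty_modularParametrizationData)
    (hnf : exists_isNewformOf) (hHL : HoffsteinLuo1997_exists_twist_L_one_ne_zero)
    (hMaz : mazur_not_dvd_maninConstant_of_odd) (hNS : integral_neronScaling_of_isGloballyMinimal)
    -- the pair (anomalous allowed)
    (W : WeierstrassCurve ℚ) [W.IsElliptic] [W.IsGloballyMinimal] (p : ℕ) [Fact p.Prime]
    (hp3 : 3 ≤ p) (hord : GoodOrd W p) (hsurj : Surj W p) (hr : W.analyticRank = 1)
    -- Jetchev's setting: `E` optimal; the Tamagawa `p`-divisibility concentrated at one bad prime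
    (hopt : ∀ (N : ℕ) [NeZero N], W.conductorNorm ℤ = N →
      ∃ Dt : ModularParametrizationData W N,
        ∀ z ∈ Dt.L.lattice, ∃ w ∈ periodLattice Dt.f, z = (Dt.c : ℂ) * w)
    (htam1 : ∃ (q : ℕ) (_ : Fact q.Prime), q ∣ W.conductorNorm ℤ ∧
      padicValNat p W.tamagawaProduct ≤ padicValNat p ((W.baseChange ℚ_[q]).localTamagawaNumber ℤ_[q]))
    -- the column's typed cyclotomic main conjecture at `p`, and the (im)-from-surj witness at `p`
    (hMC : ∀ (V : WeierstrassCurve ℚ) [V.IsElliptic] [V.IsGloballyMinimal],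
      GoodOrd V p → Irr V p → BigIm V p → MazurMainConjecture V p)
    (hIm : ∀ (V : WeierstrassCurve ℚ) [V.IsElliptic] [V.IsGloballyMinimal],
      GoodOrd V p → Surj V p → BigIm V p)
    -- (irred_K) at the imaginary quadratic fields with `p` split — JSW's hypothesis
    (hIrrK : ∀ (K : Type) [Field K] [NumberField K], IsImaginaryQuadratic K →
      SatisfiesHeegnerHypothesis (W.conductorNorm ℤ) K → SatisfiesHeegnerHypothesis p K →
      (W.baseChange K).HasIrreducibleModPGaloisRep p)
    -- (IMC≥∘BDP)ᵍ at this pair's classical Heegner data, JSW/Castella convention — the typed input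
    (hLA : ∀ (N : ℕ) [NeZero N] (K : Type) [Field K] [NumberField K]
      (Dt : ModularParametrizationData W N) (H : HeegnerDatum N (NumberField.discr K)) (ιC : K →+* ℂ)
      (P : (W.baseChange K).toAffine.Point),
      W.conductorNorm ℤ = N → IsImaginaryQuadratic K → Odd (NumberField.discr K) →
      NumberField.discr K < -4 → SatisfiesHeegnerHypothesis N K → SatisfiesHeegnerHypothesis p K →
      (W.quadraticTwist (NumberField.discr K : ℚ)).entireLFunction 1 ≠ 0 →
      WeierstrassCurve.Affine.Point.map ιC.toRatAlgHom P = heegnerPointComplex Dt H →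
      ¬ (p : ℤ) ∣ Dt.c → ¬ IsOfFinAddOrder P →
      ∀ (κ : ZpExtension K p), κ.IsAnticyclotomic →
        ∀ (γ : Field.absoluteGaloisGroup K) [Fact (κ.IsTopGenerator γ)] (ι : K →+* ℚ_[p]),
          X11b.IMCLowerWaldspurgerOnTreeGoodAt p κ (X11b.inducedPlace ι) γ ι P) :
    BSDp W p := by
  refine bsdp_rankOne_of_indexLowerBoundAt_of_columnMainConjecture_of_jetchev hGZ hKo hJ hGr hGZK hmod
    hpar hnf hHL hMaz hNS W p hp3 hord hsurj hr hopt htam1 hMC hIm ?_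
  intro N _ K _ _ Dt H ιC P hN hK hodd hlt hHN hHp hLt hP hc
  -- the Heegner point is non-torsion (Gross–Zagier + modularity at `r_an = 1`)
  have hPinf : ¬ IsOfFinAddOrder P :=
    X11b.not_isOfFinAddOrder_of_heegner_of_analyticRank_eq_one W N K Dt H ιC P (hGZ N W K) hmod hr hK
      hHN hLt hP
  -- (irred_K) at this field
  have hirrK : (W.baseChange K).HasIrreducibleModPGaloisRep p :=
    hIrrK K hK (by rw [hN]; exact hHN) hHp
  -- one anticyclotomic datum `(κ, γ)`, a prime `𝔭 ∣ p`, the embedding at `𝔭`, its induced prime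
  obtain ⟨κ, γ, 𝔭, hκ, hγ, h𝔭⟩ := X11b.exists_anticyclotomic_generator_prime (p := p) hK
  haveI : Fact (κ.IsTopGenerator γ) := ⟨hγ⟩
  have hsplit : X11b.SplitsIn K p := hHp p Fact.out (dvd_refl p)
  obtain ⟨he, hf⟩ := X11b.degreeOne_of_splitsIn hK.1 hsplit h𝔭
  set ι : K →+* ℚ_[p] := X11b.embAt K p 𝔭 h𝔭 he hf with hι
  exact X11b.indexLowerBoundAt_of_heegner_of_thm331_of_embedding W p N K Dt H ιC P h331 (hGZ N W K)
    (hKo N W K) hmod hGZK hp3 hord.1 hr hN hK hHN hHp hirrK hLt hP hκ ι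
    (hLA N K Dt H ιC P hN hK hodd hlt hHN hHp hLt hP hc hPinf κ hκ γ ι)

end Summit.BirchSwinnertonDyer.Rank1Residual

end
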